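import Summits.QuantumAdvantage.QuantumAdvantage.Theorems.CubicForrelationSignedCubicForrelationNotPrBPPDescentStep
import Literature.Computability.QuantumComplexity.MSubspaceSignReadoutRelaxedRuns
import Literature.Computability.QuantumComplexity.SignedForrelationGadget

/-!
# Exact pairs descend EXACTLY along radical directions (support item stmt-QuantumAdvantage-14671)

Route `CubicForrelation`, item `SignedExactCubicForrelationInPrBPP` (= `¬` crux r3). The kernel-descent step of the
r7 / `Sketch` chain (`Theorems.SignedCubicForrelationNotPrBPP.descent_step`, landed for the `3/5` problem) rewrites the
signed Forrelation of a cubic pair `(a, b)` on `n + 2` bits whose second function has an AFFINE derivative `D_h b`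
(`h ≠ 0` in the radical of the cubic AND quadratic structure) either as `Φ(a,b) = Φ(a″,B)/√2` (periodic direction) or as
the plain average `Φ(a,b) = ¼ Σ_{q₀,q₁} Φ(a′_q, B_q)` of four explicit cubic pairs on `n` bits.

On the EXACT slice this step loses nothing and needs no threshold bookkeeping:

* `forrelation_ne_sqrt_two_inv_mul` — the periodic alternative is impossible when `Φ(a,b) = ±1`
  (`|Φ(a″,B)|/√2 ≤ 1/√2 < 1`);
* `quarter_eq_of_avg_eq_sign` — an average of four numbers of `[-1, 1]` equal to `±1` forces all four to be `±1`;
* `exact_quarters_of_affine_derivative` — hence an exact cubic pair with a radical direction of `b` yields FOUR explicit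
  exact cubic pairs on `n` bits, each with the SAME sign `Φ(a′_q, B_q) = Φ(a,b)` (and `exact_quarter_pair` packages one
  of them with its degree certificates `descent_quarter_pairs_cubic`).

So for the sign problem on exact cubic pairs one may assume, at no cost and deterministically (the maps of
`stub_kernelNormalForm` are explicit affine changes of variables), that the cubic form of `b` — and symmetrically of `a`,
`Φ(b,a) = Φ(a,b)` — is RADICAL-FREE: the residual instances of `PairFinderExact` are the radical-free ones (in
Maiorana–McFarland coordinates: `π` without affine components and without affine directions compatible with `h`).

References: [AaronsonAmbainis2018] §1.1.1, §1.1.3 (`|Φ| ≤ 1`); C. Carlet, Boolean Functions for Cryptography and Coding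
Theory (2021), §6.1 (restrictions of bent functions to hyperplanes and codimension-2 flats, duals).
-/

noncomputable section

set_option linter.dupNamespace false -- D-0017: single-problem summit ⇒ `QuantumAdvantage.QuantumAdvantage` by design

namespace Summit.QuantumAdvantage.QuantumAdvantage.Theorems.SignedExactCubicForrelationInPrBPP.Descent

open Finset
open Literature.Computability.QuantumComplexity
open Literature.Computability.QuantumComplexity.BuzetChailloux (bxor zeroVec)
open Summit.QuantumAdvantage.QuantumAdvantage.Theorems.SignedCubicForrelationNotPrBPP (descent_step
  descent_quarter_pairs_cubic)

/-- **The periodic alternative is impossible on an exact pair**: `Φ(a,b) = ±1` is never `Φ(a″,B)/√2`, since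
`|Φ(a″,B)| ≤ 1 < √2`. [cite: AaronsonAmbainis2018, §1.1.3] -/
theorem forrelation_ne_sqrt_two_inv_mul {n m : ℕ} {a b : (Fin n → Bool) → Bool}
    (hΦ : forrelation a b = 1 ∨ forrelation a b = -1) (a'' B : (Fin m → Bool) → Bool) :
    forrelation a b ≠ (Real.sqrt 2)⁻¹ * forrelation a'' B := by
  intro h
  have h1 : |forrelation a'' B| ≤ 1 := SgnForrMem.abs_forrelation_le_one a'' B
  have hs : (1 : ℝ) < Real.sqrt 2 := by
    rw [show (1 : ℝ) = Real.sqrt 1 from Real.sqrt_one.symm]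
    exact Real.sqrt_lt_sqrt (by norm_num) (by norm_num)
  have hpos : (0 : ℝ) < Real.sqrt 2 := by positivity
  have habs : |forrelation a b| = 1 := by rcases hΦ with h' | h' <;> rw [h'] <;> norm_num
  have : |forrelation a b| ≤ (Real.sqrt 2)⁻¹ := by
    rw [h, abs_mul, abs_of_pos (inv_pos.2 hpos)]
    exact mul_le_of_le_one_right (inv_pos.2 hpos).le h1
  rw [habs] at this
  have : Real.sqrt 2 ≤ 1 := by
    have := mul_le_mul_of_nonneg_left this hpos.le
    rwa [mul_one, mul_inv_cancel₀ hpos.ne'] at this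
  linarith

/-- **An average of four values of `[-1,1]` which is `±1` is attained by every term.** [folklore] -/
theorem quarter_eq_of_avg_eq_sign (Φ : Bool → Bool → ℝ) (hle : ∀ q₀ q₁, |Φ q₀ q₁| ≤ 1) {s : ℝ}
    (hs : s = 1 ∨ s = -1) (havg : s = (1 / 4 : ℝ) * ∑ q₀ : Bool, ∑ q₁ : Bool, Φ q₀ q₁) (q₀ q₁ : Bool) :
    Φ q₀ q₁ = s := by
  simp only [Fintype.sum_bool] at havg
  have h1 := abs_le.1 (hle true true)
  have h2 := abs_le.1 (hle true false)
  have h3 := abs_le.1 (hle false true)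
  have h4 := abs_le.1 (hle false false)
  obtain ⟨h1a, h1b⟩ := h1
  obtain ⟨h2a, h2b⟩ := h2
  obtain ⟨h3a, h3b⟩ := h3
  obtain ⟨h4a, h4b⟩ := h4
  rcases hs with rfl | rfl <;> cases q₀ <;> cases q₁ <;> linarith

/-- **Exact cubic pairs descend exactly along radical directions.** Let `(a, b)` be cubic on `n + 2` bits with
`Φ(a,b) = ±1`, and let `h ≠ 0` be a direction in which the derivative `D_h b` is affine. Then the kernel-descent step
produces `a′` (cubic), `c₀`, `B₀` (cubic), `B₁` (quadratic) such that EACH of the four quarter pairs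
`(u ↦ a′(q₀,q₁,u) ⊕ q₀q₁ ⊕ q₁c₀, u ↦ B₀ u ⊕ q₀ B₁ u)` on `n` bits has forrelation exactly `Φ(a,b)`: the periodic
alternative of `descent_step` is excluded by `|Φ| = 1`, and the average of four values of `[-1,1]` equals `±1` only if all
do. [cite: AaronsonAmbainis2018, §1.1.1] -/
theorem exact_quarters_of_affine_derivative (n : ℕ) (a b : (Fin (n + 2) → Bool) → Bool) (h : Fin (n + 2) → Bool)
    (hh : h ≠ zeroVec) (ha : IsDegLeFun 3 a) (hb : IsDegLeFun 3 b)
    (hder : IsDegLeFun 1 (fun x => b x ^^ b (bxor x h)))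
    (hΦ : forrelation a b = 1 ∨ forrelation a b = -1) :
    ∃ (a' : (Fin (n + 2) → Bool) → Bool) (c₀ : Bool) (B₀ B₁ : (Fin n → Bool) → Bool),
      IsDegLeFun 3 a' ∧ IsDegLeFun 3 B₀ ∧ IsDegLeFun 2 B₁ ∧
      ∀ q₀ q₁ : Bool,
        forrelation (fun u => (a' (Fin.cons q₀ (Fin.cons q₁ u)) ^^ (q₀ && q₁)) ^^ (q₁ && c₀))
          (fun u => B₀ u ^^ (q₀ && B₁ u)) = forrelation a b := by
  rcases descent_step n a b h hh ha hb hder with ⟨a'', c, B, -, -, hper⟩ | ⟨a', c₀, B₀, B₁, ha', hB₀, hB₁, havg⟩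
  · exact absurd hper (forrelation_ne_sqrt_two_inv_mul hΦ _ _)
  · refine ⟨a', c₀, B₀, B₁, ha', hB₀, hB₁, fun q₀ q₁ => ?_⟩
    exact quarter_eq_of_avg_eq_sign
      (fun q₀ q₁ => forrelation (fun u => (a' (Fin.cons q₀ (Fin.cons q₁ u)) ^^ (q₀ && q₁)) ^^ (q₁ && c₀))
        (fun u => B₀ u ^^ (q₀ && B₁ u)))
      (fun _ _ => SgnForrMem.abs_forrelation_le_one _ _) hΦ havg q₀ q₁

/-- **One exact cubic quarter pair, packaged**: under the same hypotheses there is an explicit CUBIC pair `(a₁, b₁)` on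
`n` bits (the quarter `q₀ = q₁ = false` of the kernel descent, degrees by `descent_quarter_pairs_cubic`) with
`Φ(a₁,b₁) = Φ(a,b)` — the sign problem on exact cubic pairs with a radical direction of `b` reduces, exactly and with the
same sign, to `n` bits. [cite: AaronsonAmbainis2018, §1.1.1] -/
theorem exact_quarter_pair (n : ℕ) (a b : (Fin (n + 2) → Bool) → Bool) (h : Fin (n + 2) → Bool)
    (hh : h ≠ zeroVec) (ha : IsDegLeFun 3 a) (hb : IsDegLeFun 3 b)
    (hder : IsDegLeFun 1 (fun x => b x ^^ b (bxor x h)))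
    (hΦ : forrelation a b = 1 ∨ forrelation a b = -1) :
    ∃ (a₁ b₁ : (Fin n → Bool) → Bool), IsDegLeFun 3 a₁ ∧ IsDegLeFun 3 b₁ ∧
      (∃ (a' : (Fin (n + 2) → Bool) → Bool) (c₀ : Bool) (B₀ B₁ : (Fin n → Bool) → Bool),
        a₁ = (fun u => (a' (Fin.cons false (Fin.cons false u)) ^^ (false && false)) ^^ (false && c₀)) ∧
        b₁ = (fun u => B₀ u ^^ (false && B₁ u))) ∧
      forrelation a₁ b₁ = forrelation a b := by
  obtain ⟨a', c₀, B₀, B₁, ha', hB₀, hB₁, hq⟩ := exact_quarters_of_affine_derivative n a b h hh ha hb hder hΦ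
  obtain ⟨h1, h2⟩ := descent_quarter_pairs_cubic ha' hB₀ hB₁ c₀ false false
  exact ⟨_, _, h1, h2, ⟨a', c₀, B₀, B₁, rfl, rfl⟩, hq false false⟩

/-- **Symmetric form**: a radical direction of `a` serves as well (`Φ(b,a) = Φ(a,b)`), the quarter pairs then being
built from `b` restricted and `a` folded. [cite: AaronsonAmbainis2018, §1.1.1] -/
theorem exact_quarter_pair_left (n : ℕ) (a b : (Fin (n + 2) → Bool) → Bool) (h : Fin (n + 2) → Bool)
    (hh : h ≠ zeroVec) (ha : IsDegLeFun 3 a) (hb : IsDegLeFun 3 b)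
    (hder : IsDegLeFun 1 (fun x => a x ^^ a (bxor x h)))
    (hΦ : forrelation a b = 1 ∨ forrelation a b = -1) :
    ∃ (a₁ b₁ : (Fin n → Bool) → Bool), IsDegLeFun 3 a₁ ∧ IsDegLeFun 3 b₁ ∧ forrelation a₁ b₁ = forrelation a b := by
  have hΦ' : forrelation b a = 1 ∨ forrelation b a = -1 := by
    rw [MMReadout.forrelation_symm' a b]; exact hΦ
  obtain ⟨b₁, a₁, hb₁, ha₁, -, hq⟩ := exact_quarter_pair n b a h hh hb ha hder hΦ'
  exact ⟨a₁, b₁, ha₁, hb₁, by rw [← MMReadout.forrelation_symm' a₁ b₁, hq, MMReadout.forrelation_symm' a b]⟩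

end Summit.QuantumAdvantage.QuantumAdvantage.Theorems.SignedExactCubicForrelationInPrBPP.Descent

end
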